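import Mathlib
import Summits.CriticalPhenomena.PercolationContinuityZ3.Theses.PercNearOneGluing
import Literature.Probability.Percolation.PercolationEvents
import HarnessLib

/-!
# KN Conjecture 1 implies `NearOneGluing`

Stub `stub_conj1Gluing` of line `kn_shortening_induction` (crux strategist s1, 2026-08-16) for the crux
`PercNearOneGluing.NearOneGluing` (item stmt-CriticalPhenomena-4574 = Kozma–Nitzan Conjecture 3 over all finite
weighted graphs).

The HYPOTHESIS is Kozma–Nitzan's Conjecture 1 (arXiv:2401.12397 p.3) in min-free typing: on every finite weighted
graph, every common lower bound `t` of the `P(a ↔ b)`, `a ∈ A`, satisfies `P(o ↔ A) · t ≤ P(o ↔ b)`.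
The CONCLUSION is `NearOneGluing` by name, with `δ := min (ε/2) (1/2)`: for an instance at level `δ` take
`t := 1 − δ`; then `P(o ↔ b) ≥ P(o ↔ A)(1 − δ) > (1 − δ)² ≥ 1 − 2δ ≥ 1 − ε`
(KN p.15: "Conjecture 3 clearly follows from Conjecture 1").
-/

namespace Summit.CriticalPhenomena.PercolationContinuityZ3.Theorems

open MeasureTheory Set Literature.Probability.LatticeModels Literature.Probability.Percolation
open scoped Classical BigOperators

/-- **KN Conjecture 1 implies `NearOneGluing`** (registered stub `stub_conj1Gluing` of the line
`Cruxes/NearOneGluing/Lines/kn_shortening_induction.lean`, verbatim signature).  With `δ := min (ε/2) (1/2)` and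
`t := 1 − δ`: `P(o ↔ b) ≥ P(o ↔ A)·(1 − δ) > (1 − δ)² = 1 − 2δ + δ² ≥ 1 − ε`. [folklore] -/
theorem stub_conj1Gluing :
    (∀ (n : ℕ) (w : Sym2 (Fin n) → unitInterval) (A : Finset (Fin n)) (o b : Fin n) (t : ℝ),
      (∀ a ∈ A, t ≤ (prodBernoulli w).real (openConn a b)) →
      (prodBernoulli w).real (⋃ a ∈ A, openConn o a) * t ≤ (prodBernoulli w).real (openConn o b)) →
    Summit.CriticalPhenomena.PercolationContinuityZ3.Theses.PercNearOneGluing.NearOneGluing := by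
  intro hC1 ε hε
  refine ⟨min (ε / 2) (1 / 2), lt_min (by positivity) (by norm_num), ?_⟩
  intro n w A o b hoA hab
  set δ : ℝ := min (ε / 2) (1 / 2) with hδ
  have hδε : δ ≤ ε / 2 := min_le_left _ _
  have hδh : δ ≤ 1 / 2 := min_le_right _ _
  have hpos : 0 < 1 - δ := by linarith
  have h1 : (prodBernoulli w).real (⋃ a ∈ A, openConn o a) * (1 - δ) ≤
      (prodBernoulli w).real (openConn o b) :=
    hC1 n w A o b (1 - δ) fun a ha => (hab a ha).le
  have key : (1 - δ) * (1 - δ) < (prodBernoulli w).real (⋃ a ∈ A, openConn o a) * (1 - δ) :=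
    mul_lt_mul_of_pos_right hoA hpos
  nlinarith [key, h1, hδε, sq_nonneg δ]

end Summit.CriticalPhenomena.PercolationContinuityZ3.Theorems
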